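import Summits.QuantumFields.YangMills.Theorems.UnitScaleTiltProp7MassiveColumnBlockDecay
import Summits.QuantumFields.YangMills.Theorems.UnitScaleTiltProp7MemberCoshWeight
import Summits.QuantumFields.YangMills.Theorems.UnitScaleTiltProp7KatoBootstrapMemberDecay
import HarnessLib

/-!
# Route `UnitScaleTilt`, crux K1 «MinimiserStabilityRegPr» (stmt-QuantumFields-19200), EX face after S45 — **(L3′b)-VALUE FILE V4 (= V2 ⊕ V3): THE POINTWISE EXPONENTIAL DECAY OF
# THE LOD COLUMNS `ψ_y = G_a(Q″†(δ_y ⊗ Y))` AT A CURVED BACKGROUND, K-FREE** — print's (3.42) first entry WITH its factor `e^{−δ₀d(y,y′)}` for the massive site propagator of the LOD line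
# (★★OWNER RULING №35-A∕B; chair ★`ym-ust-19200-p1` g25's pen V4, CHAIR WORD №4 (c); over w5's V3 ✓`Prop7KatoBootstrapMemberDecay`, my V4a ✓`Prop7MassiveColumnBlockDecay` and V4b-1
# ✓`Prop7MemberCoshWeight`)

Cell `ym3-torus` (HUMAN RULING D-0037; rung R3 — NOT d = 4, NOT infinite volume, NOT a mass gap, NOT Clay).  THEOREMS ONLY (0 `def`, 0 `sorry`); `--supports stmt-QuantumFields-19200 --as helper`.
THE ASSEMBLY (lit ✓`B9Eq342GreenPrimeSupBoundDecay`'s storey (D), at the member): weight `W = Π_μ cosh(a·circAbs_μ(x₀ − ·))`, `a := κη`, `κ := min μ (1∕4)` (per-block rate `κ ≤ μ`,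
`λ ≥ 1∕2`); source and penalty DOMINATED by `s·λ·W` with `s ∝ e^{−κ·d(B(x₀),y)}` (V2b, V4a, V4b-1 + the coarse triangle inequality); (D-E) bracket `Σ c₀‖ψ‖²∕W ∝ e^{−κ·d}` (V4a per block,
✓`sum_exp_neg_mul_tdist_coarse_le`); then V3.
WHAT IS PROVED (ns `Summit.QuantumFields.YangMills.Theorems.Prop7MassiveColumnPointwiseDecay`).
* §1 ★`rate_window` (`a = κη`, `κ = min μ (1∕4)`: `0 < a`, `1∕2 ≤ λ`), `normSq_equiv_eq` (`‖u(σx)‖²_{W₂} = Σ_jk |u′ x j k|²`), `sum_weighted_normSq_eq_blocks`.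
* §2 ★★★ `norm_equiv_massiveColumn_apply_le_decay` — for `U₀ ∈ RegPr F n K ε₀` (`10⁷L³ε₀ ≤ 1`), ANY top mean of record `Q″` with lift `ι`, adjoint `T`, massive inverse `G` (`hAG`), `a > 0`,
  `μ > 0` inside the Agmon window (`hδ hwin` at slopes `μη`, `3μ` — routeR-w4's ✓`Prop7LODSlotK2WindowLetters` closes them), every coarse `y`, fibre value `Y`, fine `x₀`:
  `‖(G(Q″†(δ_y⊗Y)))(x₀)‖_{W₂} ≤ (B₁·e^{−κ·tdist(B(x₀),y)} + B₂·e^{−(κ∕2)·tdist(B(x₀),y)})·‖Y‖`, `κ = min μ (1∕4)`, `B₁ = 14·8e^{3κ}(F₀ + e^{3μ}p_BC_col)`,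
  `B₂ = √(3³∕(c₀ℓ³)·8)·√(8e^{3κ+6μ}(2(1+1∕μ))³)·C_col` — ALL K-FREE at the pins `c₁ = c₀ℓ³` (then `F₀ = (5∕2)`-class, `p_B = (25∕8)a`-class, `C_col√(1∕(c₀ℓ³)) = 8C_P²·(5∕(2√2))`-class).
HONEST SCOPE.  Composition of landed rows; CONDITIONAL only on the LOD letters, `RegPr` and the displayed Agmon window; VALUE row of the SITE propagator's columns only — no gradient ((L3′b)-GRAD),
no one-form `G = Δ_a⁻¹`, no `P = BM⁻¹Bᴴ` assembly yet (V5); nothing of the ten EX rows, `hT`, `hGF`, EX or the crux is proved here.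

References: T. Bałaban, CMP **99** (1985) 389–434 [Balaban1985BackgroundPropagators] (Thm 3.1 (3.42) p.397, (3.24) p.394, (3.49) p.399); CMP **95** (1984) 17–40 [Balaban1984PropagatorsI] (p.36); J. Dodziuk, V. Mathai, Contemp. Math. **398** (2006) [DodziukMathai2006] (§1).
-/

set_option autoImplicit false

noncomputable section

open scoped BigOperators Matrix.Norms.L2Operator InnerProductSpace ComplexConjugate

namespace Summit.QuantumFields.YangMills.Theorems.Prop7MassiveColumnPointwiseDecay

open Literature.MathematicalPhysics.QuantumFieldTheory.Balaban1983to89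
open T4Continuum BlockAveraging
open BlockAveraging (Idx)
open B7Prop1Explicit (disp)
open B5Eq118OneStroke (iterBlockOf iterBlock mem_iterBlock)
open B10Eq27TorusAxialLog (holT transl)
open B7TransferAnalyticMean (meanCLM)
open B4Sect5Torus (TSite)
open B9SectCLatticeCarrier (shift unshift)
open B4TorusKernel.MultiPeriod (circAbs)
open B9Eq311L2Pairing (WL2)
open B11Eq103H1Complex (SiteL2K)
open B9Eq342CoshWeightSite (weight_site_pos weight_site_centre)
open Summit.QuantumFields.YangMills.Theorems.Prop8Chart (emlIterU)
open Literature.MathematicalPhysics.QuantumFieldTheory.Balaban1983to89.T3ContinuumYM3Torus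
open T3SectALandauChart (eta eta_pos bgUnits)
open T3PrintedRegularMinimiser (RegPr)
open T3PrintedRegularOrbits (sites_eq)
open T3LevelShift (siteShift)
open Summit.QuantumFields.YangMills.Theorems.Prop7SectET3Transport (periodsT3 siteEquiv)
open Summit.QuantumFields.YangMills.Theorems.Prop7SectET3HilbertLetters (W₂ frobEquiv toL2S covLapSite toL2S_apply frobEquiv_symm_apply_apply)
open Summit.QuantumFields.YangMills.Theorems.Prop7LaplaceAFlatLetters (norm_sq_toL2S)
open Summit.QuantumFields.YangMills.Theorems.Prop7BlockBumpExtension (sum_eq_sum_iterBlock)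
open Summit.QuantumFields.YangMills.Theorems.Prop7BlockDistanceWeights (sum_exp_neg_mul_tdist_coarse_le tdist_coarse_comm tdist_coarse_triangle eta_mul_pow_eq_one)
open Summit.QuantumFields.YangMills.Theorems.Prop7TopMeanAdjointBlockLocal (adjoint_apply_eq_zero_off_block)
open Summit.QuantumFields.YangMills.Theorems.Prop7ComplementaryProjectorBlockDecay (inner_lift_eq_zero_of_disjoint)
open Summit.QuantumFields.YangMills.Theorems.Prop7MassiveColumnSupBound (norm_equiv_column_source_le)
open Summit.QuantumFields.YangMills.Theorems.Prop7MassiveColumnBlockDecay (norm_blockCut_massiveColumn_le norm_equiv_penalty_column_le)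
open Summit.QuantumFields.YangMills.Theorems.Prop7MemberCoshWeight (weight_supersolution_member exp_blockDist_le_weight)
open Summit.QuantumFields.YangMills.Theorems.Prop7KatoBootstrapMemberDecay (norm_apply_le_of_kato_member_weighted_of_letter sum_range_three_inv)

variable (F : T3Family) {n K : ℕ} (h : n ≤ K) {c₀ c₁ : ℝ} [Fact (0 < c₀)] [Fact (0 < c₁)]
  {ε₀ : ℝ} (hε₀ : 0 < ε₀) (hε7 : 10 ^ 7 * (F.L : ℝ) ^ 3 * ε₀ ≤ 1)
  (U₀ : GaugeField (F.P K) 0 (Matrix.specialUnitaryGroup (Fin 2) ℂ)) (hreg : RegPr F n K ε₀ U₀)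
  (Q'' : SiteL2K ℂ 3 (periodsT3 F K) c₀ W₂ →ₗ[ℂ] (Site (F.P K) (K - n) → Matrix (Fin 2) (Fin 2) ℂ))
  (hseq : ∀ lam : Site (F.P K) 0 → Matrix (Fin 2) (Fin 2) ℂ, ∃ ns : (j : ℕ) → Site (F.P K) j → Matrix (Fin 2) (Fin 2) ℂ, ns 0 = lam ∧
      (∀ (j : ℕ) (y : Site (F.P K) (j + 1)), ns (j + 1) y = ns j (emb y) - meanCLM (Idx (F.P K)) (Matrix (Fin 2) (Fin 2) ℂ) fun i : Idx (F.P K) =>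
        ns j (emb y) - ((holT (emlIterU j (bgUnits F K U₀)) (emb y) (stairWord i.2.1 (off i.1)) : (Matrix (Fin 2) (Fin 2) ℂ)ˣ) : Matrix (Fin 2) (Fin 2) ℂ) *
          ns j (transl (emb y) (disp (stairWord i.2.1 (off i.1)))) * (((holT (emlIterU j (bgUnits F K U₀)) (emb y) (stairWord i.2.1 (off i.1)))⁻¹ : (Matrix (Fin 2) (Fin 2) ℂ)ˣ) : Matrix (Fin 2) (Fin 2) ℂ)) ∧
      ns (K - n) = Q'' (toL2S F K c₀ lam))
  (ι : (Site (F.P K) (K - n) → Matrix (Fin 2) (Fin 2) ℂ) →ₗ[ℂ] SiteL2K ℂ 3 (periodsT3 F n) c₁ W₂)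
  (hι : ∀ c, ι c = toL2S F n c₁ (fun z => c (siteShift (sites_eq F n K h) z)))
  (T : SiteL2K ℂ 3 (periodsT3 F n) c₁ W₂ →ₗ[ℂ] SiteL2K ℂ 3 (periodsT3 F K) c₀ W₂)
  (hT : ∀ (l : SiteL2K ℂ 3 (periodsT3 F K) c₀ W₂) (f : SiteL2K ℂ 3 (periodsT3 F n) c₁ W₂), ⟪ι (Q'' l), f⟫_ℂ = ⟪l, T f⟫_ℂ)
  {a : ℝ} (ha : 0 < a)
/-! ## §1 The rate window and two readings -/
omit [Fact (0 < c₀)] [Fact (0 < c₁)] in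
/-- ★ **THE RATE WINDOW, K-UNIFORM**: with `κ := min μ (1∕4)` and `a := κ·η` (per fine site; `κ` per block): `0 < a`, `a ≤ 1`, and `1∕2 ≤ λ := 1 − 2·3·η⁻²(cosh a − 1)`
(`η⁻²a² = κ² ≤ 1∕16`). [cite: Balaban1985BackgroundPropagators, Thm 3.1 p.397; Balaban1984PropagatorsI, p.36] -/
theorem rate_window {μ : ℝ} (hμ : 0 < μ) :
    0 < min μ (1 / 4) * eta F n K ∧ min μ (1 / 4) * eta F n K ≤ 1 ∧
      (1 : ℝ) / 2 ≤ 1 - 2 * (3 : ℕ) * (eta F n K)⁻¹ ^ 2 * (Real.cosh (min μ (1 / 4) * eta F n K) - 1) := by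
  have hη : 0 < eta F n K := eta_pos F n K
  have hη1 : eta F n K ≤ 1 := by
    rw [eta]; exact pow_le_one₀ (by positivity) (inv_le_one_of_one_le₀ (by have := F.hL.2; exact_mod_cast this.le))
  have hκ0 : 0 < min μ (1 / 4) := lt_min hμ (by norm_num)
  have hκ4 : min μ (1 / 4) ≤ 1 / 4 := min_le_right _ _
  have ha0 : 0 < min μ (1 / 4) * eta F n K := mul_pos hκ0 hη
  have ha1 : min μ (1 / 4) * eta F n K ≤ 1 := by nlinarith
  refine ⟨ha0, ha1, ?_⟩
  -- `cosh t − 1 ≤ t²` on `[0, 1]` (lit ✓`B9Thm31GpAgmonDecayCoarseZd.cosh_sub_one_le_sq`, inlined)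
  have hc : Real.cosh (min μ (1 / 4) * eta F n K) - 1 ≤ (min μ (1 / 4) * eta F n K) ^ 2 := by
    set t := min μ (1 / 4) * eta F n K
    have h1 : Real.cosh t ≤ Real.exp (t ^ 2 / 2) := Real.cosh_le_exp_half_sq t
    have hs : |t ^ 2 / 2| ≤ 1 := by rw [abs_of_nonneg (by positivity)]; nlinarith only [ha0, ha1]
    have h2 : |Real.exp (t ^ 2 / 2) - 1| ≤ 2 * |t ^ 2 / 2| := Real.abs_exp_sub_one_le hs
    rw [abs_of_nonneg (by positivity : (0 : ℝ) ≤ t ^ 2 / 2)] at h2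
    have h3 := (le_abs_self _).trans h2
    linarith only [h1, h3]
  have hkey : (eta F n K)⁻¹ ^ 2 * (Real.cosh (min μ (1 / 4) * eta F n K) - 1) ≤ (1 / 4) ^ 2 := by
    calc (eta F n K)⁻¹ ^ 2 * (Real.cosh (min μ (1 / 4) * eta F n K) - 1) ≤ (eta F n K)⁻¹ ^ 2 * (min μ (1 / 4) * eta F n K) ^ 2 :=
          mul_le_mul_of_nonneg_left hc (by positivity)
      _ = (min μ (1 / 4)) ^ 2 := by field_simp
      _ ≤ (1 / 4) ^ 2 := pow_le_pow_left₀ hκ0.le hκ4 2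
  have h3 : ((3 : ℕ) : ℝ) = 3 := by norm_num
  rw [h3]
  nlinarith [hkey]

omit [Fact (0 < c₀)] [Fact (0 < c₁)] in
/-- The `W₂`-norm of a value read on the chart is the Frobenius sum of the entries: `‖u(σ x)‖² = Σ_jk ‖(toL2S⁻¹u) x j k‖²`. [cite: Balaban1985BackgroundPropagators, (3.11) p.392] -/
theorem normSq_equiv_eq (u : SiteL2K ℂ 3 (periodsT3 F K) c₀ W₂) (x : Site (F.P K) 0) :
    ‖WL2.equiv ℂ _ W₂ u (siteEquiv F K x)‖ ^ 2 = ∑ j : Fin 2, ∑ k : Fin 2, ‖(toL2S F K c₀).symm u x j k‖ ^ 2 := by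
  have hu : u = toL2S F K c₀ ((toL2S F K c₀).symm u) := ((toL2S F K c₀).apply_symm_apply u).symm
  conv_lhs => rw [hu, toL2S_apply, Equiv.symm_apply_apply]
  rw [EuclideanSpace.norm_eq, Real.sq_sqrt (Finset.sum_nonneg fun _ _ => sq_nonneg _), Fintype.sum_prod_type]
  simp only [frobEquiv_symm_apply_apply]

/-- The weighted Frobenius mass of `u` splits over the blocks: `Σ_x c₀(Σ_jk|u′ x jk|²)·g(B x) = Σ_z g(z)·‖toL2S(𝟙_{B(z)}u′)‖²`. [cite: Balaban1985BackgroundPropagators, (3.11) p.392, (3.21) p.394] -/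
theorem sum_weighted_normSq_eq_blocks (u' : Site (F.P K) 0 → Matrix (Fin 2) (Fin 2) ℂ) (g : Site (F.P K) (K - n) → ℝ) :
    ∑ x : Site (F.P K) 0, g (iterBlockOf (K - n) x) * (c₀ * ∑ j : Fin 2, ∑ k : Fin 2, ‖u' x j k‖ ^ 2)
      = ∑ z : Site (F.P K) (K - n), g z * ‖toL2S F K c₀ (fun x => if iterBlockOf (K - n) x = z then u' x else 0)‖ ^ 2 := by
  classical
  rw [sum_eq_sum_iterBlock (P := F.P K) (k := K - n)]
  refine Finset.sum_congr rfl fun z _ => ?_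
  rw [norm_sq_toL2S, sum_eq_sum_iterBlock (P := F.P K) (k := K - n)
    (f := fun x => ∑ i : Fin 2, ∑ i' : Fin 2, ‖(if iterBlockOf (K - n) x = z then u' x else 0) i i'‖ ^ 2)]
  rw [Finset.sum_eq_single z, Finset.mul_sum, Finset.mul_sum]
  · refine Finset.sum_congr rfl fun x hx => ?_
    rw [(mem_iterBlock _ _ _).mp hx, if_pos rfl]
  · intro z' _ hz'
    refine Finset.sum_eq_zero fun x hx => ?_
    rw [(mem_iterBlock _ _ _).mp hx, if_neg hz']
    simp
  · intro hz; exact absurd (Finset.mem_univ z) hz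

/-! ## §2 The pointwise decay of the columns -/
include hε₀ hε7 hreg hseq hι hT ha in
/-- ★★★ **THE POINTWISE EXPONENTIAL DECAY OF THE LOD COLUMNS AT A CURVED BACKGROUND, K-FREE** (print's (3.42) first entry WITH `e^{−δ₀d}` for the LOD line's massive site propagator):
`‖(G(Q″†(δ_y⊗Y)))(x₀)‖_{W₂} ≤ (B₁·e^{−κ·d} + B₂·e^{−(κ∕2)·d})·‖Y‖`, `d = tdist(B(x₀), y)` (coarse `ℓ¹`), `κ = min μ (1∕4)`; `B₁`, `B₂` closed in the member letters (module docstring).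
The weighted Kato bootstrap V3 with the cosh weight V4b-1, fed by V2b (source), V4a (penalty and block decay) and ✓`sum_exp_neg_mul_tdist_coarse_le`.
[cite: Balaban1985BackgroundPropagators, Thm 3.1 (3.42) p.397, (3.24) p.394, (3.49) p.399; Balaban1984PropagatorsI, p.36; DodziukMathai2006, §1] -/
theorem norm_equiv_massiveColumn_apply_le_decay
    (G : SiteL2K ℂ 3 (periodsT3 F K) c₀ W₂ →ₗ[ℂ] SiteL2K ℂ 3 (periodsT3 F K) c₀ W₂)
    (hAG : ∀ f, covLapSite F n K c₀ U₀ (G f) + (a : ℂ) • T (ι (Q'' (G f))) = f)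
    {μ : ℝ} (hμ : 0 < μ) {δ₁ : ℝ} (hδ₁ : 0 ≤ δ₁)
    (hδ : 3 * ((eta F n K)⁻¹) ^ 2 * (Real.exp (μ * eta F n K) - 1) ^ 2 + a * ((25 / 8) * (c₁ * ((((F.P K).L : ℝ) ^ (F.P K).d) ^ (K - n))⁻¹ / c₀)) * (Real.exp (3 * μ) - 1) ^ 2 ≤ δ₁ ^ 2)
    (hwin : Real.sqrt (max 2 (16 * c₀ * ((F.L : ℝ) ^ (K - n)) ^ 3 / (a * c₁))) * δ₁ ≤ 1 / 10)
    (y : Site (F.P K) (K - n)) (Y : Matrix (Fin 2) (Fin 2) ℂ) (x₀ : Site (F.P K) 0) :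
    ‖WL2.equiv ℂ _ W₂ (G (T (ι (Pi.single y Y)))) (siteEquiv F K x₀)‖
      ≤ ((14 * (8 * Real.exp (3 * min μ (1 / 4)) *
              ((5 / 4) * Real.sqrt (2 * c₁) * ((((F.P K).L : ℝ) ^ (F.P K).d) ^ (K - n))⁻¹ / c₀ * Real.sqrt (2 * c₁)
                + Real.exp (3 * μ) * ((a * ((5 / 4) * Real.sqrt (2 * c₁) * ((((F.P K).L : ℝ) ^ (F.P K).d) ^ (K - n))⁻¹ / c₀) *
                    Real.sqrt ((25 / 8) * (c₁ * ((((F.P K).L : ℝ) ^ (F.P K).d) ^ (K - n))⁻¹ / c₀))) *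
                  ((8 * Real.sqrt (max 2 (16 * c₀ * ((F.L : ℝ) ^ (K - n)) ^ 3 / (a * c₁))) ^ 2) *
                    (Real.sqrt ((25 / 8) * (c₁ * ((((F.P K).L : ℝ) ^ (F.P K).d) ^ (K - n))⁻¹ / c₀)) * Real.sqrt (2 * c₁)))))))
            * Real.exp (-(min μ (1 / 4) * (Site.tdist (iterBlockOf (K - n) x₀) y : ℝ)))
          + (Real.sqrt (3 ^ 3 / (c₀ * ((F.L : ℝ) ^ (K - n)) ^ 3) * 8) *
              (Real.sqrt (8 * Real.exp (3 * min μ (1 / 4)) * Real.exp (6 * μ) * (2 * (1 + 1 / μ)) ^ 3) *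
              ((8 * Real.sqrt (max 2 (16 * c₀ * ((F.L : ℝ) ^ (K - n)) ^ 3 / (a * c₁))) ^ 2) *
                (Real.sqrt ((25 / 8) * (c₁ * ((((F.P K).L : ℝ) ^ (F.P K).d) ^ (K - n))⁻¹ / c₀)) * Real.sqrt (2 * c₁)))))
            * Real.exp (-(min μ (1 / 4) / 2 * (Site.tdist (iterBlockOf (K - n) x₀) y : ℝ)))) * ‖Y‖ := by
  classical
  have hc₀ : 0 < c₀ := Fact.out
  have hc₁ : 0 < c₁ := Fact.out
  have hη : 0 < eta F n K := eta_pos F n K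
  have hLP := (F.P K).L_pos
  -- the rate (obtained BEFORE the abbreviations, so that `set` rewrites it)
  obtain ⟨haw0, haw1, hlam⟩ := rate_window F (n := n) (K := K) hμ
  -- (D-E) per block, (D-P) pointwise along the column (V4a), and the source size (V2b) — BEFORE the abbreviations, so that `set` rewrites them
  have hDE := fun z => norm_blockCut_massiveColumn_le F h hε₀ hε7 U₀ hreg Q'' hseq ι hι T hT ha G hAG hμ.le hδ₁ hδ hwin y Y z
  have hDP := fun x => norm_equiv_penalty_column_le F h hε₀ hε7 U₀ hreg Q'' hseq ι hι T hT ha G hAG hμ.le hδ₁ hδ hwin y Y x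
  have hSRC := fun xt => norm_equiv_column_source_le F h hε₀ hε7 U₀ hreg Q'' hseq ι hι T hT y Y xt
  set κ : ℝ := min μ (1 / 4) with hκ
  have hκ0 : 0 < κ := by rw [hκ]; exact lt_min hμ (by norm_num)
  have hκμ : κ ≤ μ := by rw [hκ]; exact min_le_left _ _
  set aw : ℝ := κ * eta F n K with haw
  set lam : ℝ := 1 - 2 * (3 : ℕ) * (eta F n K)⁻¹ ^ 2 * (Real.cosh aw - 1) with hlam_def
  have hlam0 : 0 < lam := lt_of_lt_of_le (by norm_num) hlam
  have hκℓ : aw * (F.L : ℝ) ^ (K - n) = κ := by rw [haw, mul_assoc, eta_mul_pow_eq_one F (n := n) (K := K), mul_one]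
  -- letters
  set ℓv : ℝ := ((((F.P K).L : ℝ) ^ (F.P K).d) ^ (K - n))⁻¹ with hℓv
  set F₀ : ℝ := (5 / 4) * Real.sqrt (2 * c₁) * ℓv / c₀ * Real.sqrt (2 * c₁) with hF₀
  set sv : ℝ := Real.sqrt ((25 / 8) * (c₁ * ℓv / c₀)) with hsv
  set pB : ℝ := a * ((5 / 4) * Real.sqrt (2 * c₁) * ℓv / c₀) * sv with hpB
  set CP2 : ℝ := Real.sqrt (max 2 (16 * c₀ * ((F.L : ℝ) ^ (K - n)) ^ 3 / (a * c₁))) ^ 2 with hCP2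
  set Ccol : ℝ := (8 * CP2) * (sv * Real.sqrt (2 * c₁)) with hCcol
  have hℓv0 : 0 < ℓv := by rw [hℓv]; positivity
  have hF₀0 : 0 ≤ F₀ := by rw [hF₀]; positivity
  have hsv0 : 0 ≤ sv := Real.sqrt_nonneg _
  have hpB0 : 0 ≤ pB := by rw [hpB]; positivity
  have hCcol0 : 0 ≤ Ccol := by rw [hCcol]; positivity
  clear_value κ aw lam ℓv F₀ sv pB CP2 Ccol
  -- the distance
  set d₀ : ℝ := (Site.tdist (iterBlockOf (K - n) x₀) y : ℝ) with hd₀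
  -- the column, its source and its penalty
  set u : SiteL2K ℂ 3 (periodsT3 F K) c₀ W₂ := G (T (ι (Pi.single y Y))) with hu
  set f : SiteL2K ℂ 3 (periodsT3 F K) c₀ W₂ := T (ι (Pi.single y Y)) with hf
  set q : SiteL2K ℂ 3 (periodsT3 F K) c₀ W₂ := (a : ℂ) • T (ι (Q'' u)) with hq
  have hueq : covLapSite F n K c₀ U₀ u = f - q := by
    rw [hq, hf, ← hAG (T (ι (Pi.single y Y)))]; abel
  -- the weight centred at `x₀` (opaque after this block: only its four letters are kept)
  set x₀t : TSite 3 (periodsT3 F K) := siteEquiv F K x₀ with hx₀t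
  obtain ⟨W, hWpos, hWx₀, hsup, hWdom⟩ : ∃ W : TSite 3 (periodsT3 F K) → ℝ, (∀ xt, 0 < W xt) ∧ W x₀t = 1 ∧
      (∀ yt, lam * W yt ≤ ∑ j : Fin 3 ⊕ Fin 3, (eta F n K)⁻¹ ^ 2 * (W yt - W (Sum.elim (fun ν => unshift ν yt) (fun ν => shift ν yt) j)) + 1 * W yt) ∧
      (∀ x : Site (F.P K) 0, (1 / 8) * Real.exp (-(3 * κ)) * Real.exp (κ * (Site.tdist (iterBlockOf (K - n) x₀) (iterBlockOf (K - n) x) : ℝ)) ≤ W (siteEquiv F K x)) := by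
    refine ⟨fun xt => ∏ m' : Fin 3, Real.cosh (aw * (circAbs (periodsT3 F K m') (((((x₀t m' : ℕ) : ZMod (periodsT3 F K m')) - ((xt m' : ℕ) : ZMod (periodsT3 F K m'))).val : ℕ) : ℤ) : ℝ)),
      fun xt => weight_site_pos (periodsT3 F K) aw x₀t xt, weight_site_centre (periodsT3 F K) aw x₀t,
      fun yt => by rw [hlam_def]; exact weight_supersolution_member F n K aw x₀t yt, fun x => ?_⟩
    have hx := exp_blockDist_le_weight F n K h haw0.le x₀ x
    rw [hκℓ] at hx
    rw [hx₀t]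
    exact hx
  -- the data constant
  set s : ℝ := 8 * Real.exp (3 * κ) * (F₀ + Real.exp (3 * μ) * (pB * Ccol)) * Real.exp (-(κ * d₀)) * ‖Y‖ / lam with hs
  have hs0 : 0 ≤ s := by rw [hs]; positivity
  -- data domination
  have hdata : ∀ xt, ‖WL2.equiv ℂ _ W₂ f xt‖ + ‖WL2.equiv ℂ _ W₂ q xt‖ ≤ s * (lam * W xt) := by
    intro xt
    obtain ⟨x, rfl⟩ : ∃ x, xt = siteEquiv F K x := ⟨(siteEquiv F K).symm xt, ((siteEquiv F K).apply_symm_apply xt).symm⟩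
    have hWx := hWdom x
    have hWx0 := hWpos (siteEquiv F K x)
    set dz : ℝ := (Site.tdist (iterBlockOf (K - n) x₀) (iterBlockOf (K - n) x) : ℝ) with hdz
    set dy : ℝ := (Site.tdist (iterBlockOf (K - n) x) y : ℝ) with hdy
    -- triangle: `d₀ ≤ dz + dy`
    have htri : d₀ ≤ dz + dy := tdist_coarse_triangle F (iterBlockOf (K - n) x₀) (iterBlockOf (K - n) x) y
    -- `e^{κ dz} ≤ 8e^{3κ} W`
    have hWx' : Real.exp (κ * dz) ≤ 8 * Real.exp (3 * κ) * W (siteEquiv F K x) := by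
      have h8 : Real.exp (κ * dz) = 8 * Real.exp (3 * κ) * ((1 / 8) * Real.exp (-(3 * κ)) * Real.exp (κ * dz)) := by
        rw [Real.exp_neg]; field_simp
      rw [h8]; exact mul_le_mul_of_nonneg_left hWx (by positivity)
    -- the source: `‖f‖ ≤ F₀‖Y‖·𝟙[B x = y]`
    have hfx : ‖WL2.equiv ℂ _ W₂ f (siteEquiv F K x)‖ ≤ F₀ * ‖Y‖ * Real.exp (-(κ * d₀)) * Real.exp (κ * dz) := by
      by_cases hxy : iterBlockOf (K - n) x = y
      · have h1 := hSRC (siteEquiv F K x)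
        have hd : dz = d₀ := by rw [hdz, hd₀, hxy]
        rw [hd, mul_assoc (F₀ * ‖Y‖), ← Real.exp_add, neg_add_cancel, Real.exp_zero, mul_one]
        have hF₀' : (5 / 4) * Real.sqrt (2 * c₁) * ℓv / c₀ * (Real.sqrt (2 * c₁) * ‖Y‖) = F₀ * ‖Y‖ := by rw [hF₀]; ring
        linarith only [h1, hF₀'.le, hF₀'.ge]
      · have h0 : WL2.equiv ℂ _ W₂ f (siteEquiv F K x) = 0 := by
          have hz := adjoint_apply_eq_zero_off_block F U₀ Q'' hseq ι (inner_lift_eq_zero_of_disjoint F h ι hι) T hT (Pi.single y Y) y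
            (fun y' hy' => Pi.single_eq_of_ne hy' _) x hxy
          have : f = toL2S F K c₀ ((toL2S F K c₀).symm f) := ((toL2S F K c₀).apply_symm_apply f).symm
          rw [this, toL2S_apply, Equiv.symm_apply_apply, hf, hz, map_zero]
        rw [h0, norm_zero]; positivity
    -- the penalty: `‖q‖ ≤ pB·Ccol·e^{3μ}·e^{−κ d₀}·e^{κ dz}·‖Y‖`
    have hqx : ‖WL2.equiv ℂ _ W₂ q (siteEquiv F K x)‖ ≤ Real.exp (3 * μ) * (pB * Ccol) * ‖Y‖ * Real.exp (-(κ * d₀)) * Real.exp (κ * dz) := by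
      have h1 := hDP x
      -- `e^{−μ(dy − 3)} ≤ e^{3μ}·e^{−κ d₀}·e^{κ dz}`
      have hexp : Real.exp (-(μ * (dy - 3))) ≤ Real.exp (3 * μ) * Real.exp (-(κ * d₀)) * Real.exp (κ * dz) := by
        rw [← Real.exp_add, ← Real.exp_add, Real.exp_le_exp]
        have hdy0 : 0 ≤ dy := by rw [hdy]; exact Nat.cast_nonneg _
        have h1 : κ * d₀ ≤ κ * (dz + dy) := mul_le_mul_of_nonneg_left htri hκ0.le
        have h2 : κ * dy ≤ μ * dy := mul_le_mul_of_nonneg_right hκμ hdy0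
        linarith only [h1, h2]
      have hrew : pB * (Real.exp (-(μ * (dy - 3))) * (8 * CP2) * (sv * (Real.sqrt (2 * c₁) * ‖Y‖)))
          = pB * Ccol * ‖Y‖ * Real.exp (-(μ * (dy - 3))) := by rw [hCcol]; ring
      rw [hrew] at h1
      calc _ ≤ pB * Ccol * ‖Y‖ * Real.exp (-(μ * (dy - 3))) := h1
        _ ≤ pB * Ccol * ‖Y‖ * (Real.exp (3 * μ) * Real.exp (-(κ * d₀)) * Real.exp (κ * dz)) := mul_le_mul_of_nonneg_left hexp (by positivity)
        _ = _ := by ring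
    -- assemble
    have hsum : ‖WL2.equiv ℂ _ W₂ f (siteEquiv F K x)‖ + ‖WL2.equiv ℂ _ W₂ q (siteEquiv F K x)‖
        ≤ (F₀ + Real.exp (3 * μ) * (pB * Ccol)) * ‖Y‖ * Real.exp (-(κ * d₀)) * Real.exp (κ * dz) :=
      calc _ ≤ _ := add_le_add hfx hqx
        _ = _ := by ring
    have hfin : (F₀ + Real.exp (3 * μ) * (pB * Ccol)) * ‖Y‖ * Real.exp (-(κ * d₀)) * Real.exp (κ * dz)
        ≤ (F₀ + Real.exp (3 * μ) * (pB * Ccol)) * ‖Y‖ * Real.exp (-(κ * d₀)) * (8 * Real.exp (3 * κ) * W (siteEquiv F K x)) :=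
      mul_le_mul_of_nonneg_left hWx' (by positivity)
    have hslam : s * lam = 8 * Real.exp (3 * κ) * (F₀ + Real.exp (3 * μ) * (pB * Ccol)) * Real.exp (-(κ * d₀)) * ‖Y‖ := by
      rw [hs]; exact div_mul_cancel₀ _ hlam0.ne'
    have hsdef : s * (lam * W (siteEquiv F K x)) = (F₀ + Real.exp (3 * μ) * (pB * Ccol)) * ‖Y‖ * Real.exp (-(κ * d₀)) * (8 * Real.exp (3 * κ) * W (siteEquiv F K x)) := by
      rw [← mul_assoc, hslam]; ring
    rw [hsdef]
    exact hsum.trans hfin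
  -- (D-E) bracket: `Σ c₀‖u‖²∕W ≤ EW²`
  set EW2 : ℝ := 8 * Real.exp (3 * κ) * Real.exp (6 * μ) * (2 * (1 + 1 / μ)) ^ 3 * Ccol ^ 2 * ‖Y‖ ^ 2 * Real.exp (-(κ * d₀)) with hEW2
  have hEW2_0 : 0 ≤ EW2 := by rw [hEW2]; positivity
  have hbracket : ∑ yt, c₀ * ‖WL2.equiv ℂ _ W₂ u yt‖ ^ 2 / W yt ≤ EW2 := by
    set u' : Site (F.P K) 0 → Matrix (Fin 2) (Fin 2) ℂ := (toL2S F K c₀).symm u with hu'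
    -- read the sum on the route's sites, then on blocks
    have hreidx : ∑ yt, c₀ * ‖WL2.equiv ℂ _ W₂ u yt‖ ^ 2 / W yt = ∑ x : Site (F.P K) 0, c₀ * ‖WL2.equiv ℂ _ W₂ u (siteEquiv F K x)‖ ^ 2 / W (siteEquiv F K x) :=
      ((siteEquiv F K).sum_comp (fun yt => c₀ * ‖WL2.equiv ℂ _ W₂ u yt‖ ^ 2 / W yt)).symm
    rw [hreidx]
    have hpt : ∀ x : Site (F.P K) 0, c₀ * ‖WL2.equiv ℂ _ W₂ u (siteEquiv F K x)‖ ^ 2 / W (siteEquiv F K x)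
        ≤ (8 * Real.exp (3 * κ) * Real.exp (-(κ * (Site.tdist (iterBlockOf (K - n) x₀) (iterBlockOf (K - n) x) : ℝ)))) * (c₀ * ∑ j : Fin 2, ∑ k : Fin 2, ‖u' x j k‖ ^ 2) := by
      intro x
      rw [normSq_equiv_eq F (c₀ := c₀) u x, ← hu', div_eq_mul_inv]
      have hWinv : (W (siteEquiv F K x))⁻¹ ≤ 8 * Real.exp (3 * κ) * Real.exp (-(κ * (Site.tdist (iterBlockOf (K - n) x₀) (iterBlockOf (K - n) x) : ℝ))) := by
        have hWx := hWdom x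
        have hpos : 0 < (1 / 8) * Real.exp (-(3 * κ)) * Real.exp (κ * (Site.tdist (iterBlockOf (K - n) x₀) (iterBlockOf (K - n) x) : ℝ)) := by positivity
        calc (W (siteEquiv F K x))⁻¹ ≤ ((1 / 8) * Real.exp (-(3 * κ)) * Real.exp (κ * (Site.tdist (iterBlockOf (K - n) x₀) (iterBlockOf (K - n) x) : ℝ)))⁻¹ :=
              inv_anti₀ hpos hWx
          _ = 8 * Real.exp (3 * κ) * Real.exp (-(κ * (Site.tdist (iterBlockOf (K - n) x₀) (iterBlockOf (K - n) x) : ℝ))) := by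
              rw [Real.exp_neg, Real.exp_neg]; field_simp
      calc c₀ * (∑ j : Fin 2, ∑ k : Fin 2, ‖u' x j k‖ ^ 2) * (W (siteEquiv F K x))⁻¹
          ≤ c₀ * (∑ j : Fin 2, ∑ k : Fin 2, ‖u' x j k‖ ^ 2) * (8 * Real.exp (3 * κ) * Real.exp (-(κ * (Site.tdist (iterBlockOf (K - n) x₀) (iterBlockOf (K - n) x) : ℝ)))) :=
            mul_le_mul_of_nonneg_left hWinv (by positivity)
        _ = _ := by ring
    refine (Finset.sum_le_sum fun x _ => hpt x).trans ?_
    rw [sum_weighted_normSq_eq_blocks F (c₀ := c₀) u' (fun z => 8 * Real.exp (3 * κ) * Real.exp (-(κ * (Site.tdist (iterBlockOf (K - n) x₀) z : ℝ))))]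
    -- per block: (D-E)
    have hblk : ∀ z : Site (F.P K) (K - n),
        8 * Real.exp (3 * κ) * Real.exp (-(κ * (Site.tdist (iterBlockOf (K - n) x₀) z : ℝ))) * ‖toL2S F K c₀ (fun x => if iterBlockOf (K - n) x = z then u' x else 0)‖ ^ 2
          ≤ 8 * Real.exp (3 * κ) * Real.exp (6 * μ) * Ccol ^ 2 * ‖Y‖ ^ 2 * Real.exp (-(κ * d₀)) * Real.exp (-(μ * (Site.tdist z y : ℝ))) := by
      intro z
      have h1 := hDE z
      have hC : Real.exp (-(μ * ((Site.tdist z y : ℝ) - 3))) * (8 * CP2) * (sv * (Real.sqrt (2 * c₁) * ‖Y‖)) = Real.exp (-(μ * ((Site.tdist z y : ℝ) - 3))) * Ccol * ‖Y‖ := by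
        rw [hCcol]; ring
      rw [hC] at h1
      have h0 : 0 ≤ Real.exp (-(μ * ((Site.tdist z y : ℝ) - 3))) * Ccol * ‖Y‖ := by positivity
      have h2 : ‖toL2S F K c₀ (fun x => if iterBlockOf (K - n) x = z then u' x else 0)‖ ^ 2 ≤ (Real.exp (-(μ * ((Site.tdist z y : ℝ) - 3))) * Ccol * ‖Y‖) ^ 2 :=
        pow_le_pow_left₀ (norm_nonneg _) h1 2
      -- exponent bookkeeping: `κ·d(x₀,z) + 2μ·(d(z,y) − 3) ≥ κ d₀ + μ d(z,y) − 6μ`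
      have hdz0 : 0 ≤ (Site.tdist (iterBlockOf (K - n) x₀) z : ℝ) := Nat.cast_nonneg _
      have hdzy0 : 0 ≤ (Site.tdist z y : ℝ) := Nat.cast_nonneg _
      have htri : d₀ ≤ (Site.tdist (iterBlockOf (K - n) x₀) z : ℝ) + (Site.tdist z y : ℝ) := tdist_coarse_triangle F _ z y
      have hexp : Real.exp (-(κ * (Site.tdist (iterBlockOf (K - n) x₀) z : ℝ))) * (Real.exp (-(μ * ((Site.tdist z y : ℝ) - 3)))) ^ 2
          ≤ Real.exp (6 * μ) * Real.exp (-(κ * d₀)) * Real.exp (-(μ * (Site.tdist z y : ℝ))) := by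
        rw [← Real.exp_nat_mul, ← Real.exp_add, ← Real.exp_add, ← Real.exp_add, Real.exp_le_exp]
        push_cast
        have h1 : κ * d₀ ≤ κ * ((Site.tdist (iterBlockOf (K - n) x₀) z : ℝ) + (Site.tdist z y : ℝ)) := mul_le_mul_of_nonneg_left htri hκ0.le
        have h2 : κ * (Site.tdist z y : ℝ) ≤ μ * (Site.tdist z y : ℝ) := mul_le_mul_of_nonneg_right hκμ hdzy0
        linarith only [h1, h2, hμ, hdzy0]
      calc 8 * Real.exp (3 * κ) * Real.exp (-(κ * (Site.tdist (iterBlockOf (K - n) x₀) z : ℝ))) * ‖toL2S F K c₀ (fun x => if iterBlockOf (K - n) x = z then u' x else 0)‖ ^ 2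
          ≤ 8 * Real.exp (3 * κ) * Real.exp (-(κ * (Site.tdist (iterBlockOf (K - n) x₀) z : ℝ))) * (Real.exp (-(μ * ((Site.tdist z y : ℝ) - 3))) * Ccol * ‖Y‖) ^ 2 :=
            mul_le_mul_of_nonneg_left h2 (by positivity)
        _ = 8 * Real.exp (3 * κ) * Ccol ^ 2 * ‖Y‖ ^ 2 * (Real.exp (-(κ * (Site.tdist (iterBlockOf (K - n) x₀) z : ℝ))) * (Real.exp (-(μ * ((Site.tdist z y : ℝ) - 3)))) ^ 2) := by ring
        _ ≤ 8 * Real.exp (3 * κ) * Ccol ^ 2 * ‖Y‖ ^ 2 * (Real.exp (6 * μ) * Real.exp (-(κ * d₀)) * Real.exp (-(μ * (Site.tdist z y : ℝ)))) :=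
            mul_le_mul_of_nonneg_left hexp (by positivity)
        _ = _ := by ring
    refine (Finset.sum_le_sum fun z _ => hblk z).trans ?_
    rw [← Finset.mul_sum]
    have hgeo := sum_exp_neg_mul_tdist_coarse_le F (n := n) (K := K) hμ y
    rw [hEW2]
    calc 8 * Real.exp (3 * κ) * Real.exp (6 * μ) * Ccol ^ 2 * ‖Y‖ ^ 2 * Real.exp (-(κ * d₀)) * ∑ z : Site (F.P K) (K - n), Real.exp (-(μ * (Site.tdist z y : ℝ)))
        ≤ 8 * Real.exp (3 * κ) * Real.exp (6 * μ) * Ccol ^ 2 * ‖Y‖ ^ 2 * Real.exp (-(κ * d₀)) * (2 * (1 + 1 / μ)) ^ 3 :=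
          mul_le_mul_of_nonneg_left hgeo (by positivity)
      _ = _ := by ring
  have hEW : Real.sqrt (∑ yt, c₀ * ‖WL2.equiv ℂ _ W₂ u yt‖ ^ 2 / W yt) ≤ Real.sqrt EW2 := Real.sqrt_le_sqrt hbracket
  -- V3
  have hmain := norm_apply_le_of_kato_member_weighted_of_letter F n K c₀ h U₀ hueq hlam0 hWpos hsup hs0 hdata hWx₀ hEW
  rw [sum_range_three_inv] at hmain
  -- numerical clean-up: `λ ≥ 1∕2`
  have hinv2 : lam⁻¹ ≤ 2 := by
    rw [inv_le_comm₀ hlam0 (by norm_num)]; linarith only [hlam]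
  have hinv0 : 0 ≤ lam⁻¹ := inv_nonneg.mpr hlam0.le
  have hgeom : 1 + lam⁻¹ + lam⁻¹ ^ 2 ≤ 7 := by
    have h4 : lam⁻¹ ^ 2 ≤ 2 ^ 2 := pow_le_pow_left₀ hinv0 hinv2 2
    linarith only [hinv2, h4]
  have hlam3 : (lam ^ 3)⁻¹ ≤ 8 := by
    rw [inv_le_comm₀ (by positivity) (by norm_num)]
    have : (1 / 2 : ℝ) ^ 3 ≤ lam ^ 3 := pow_le_pow_left₀ (by norm_num) hlam 3
    linarith only [this]
  -- the two terms
  have hterm1 : s * (1 + lam⁻¹ + lam⁻¹ ^ 2) ≤ 14 * (8 * Real.exp (3 * κ) * (F₀ + Real.exp (3 * μ) * (pB * Ccol))) * Real.exp (-(κ * d₀)) * ‖Y‖ := by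
    set A : ℝ := 8 * Real.exp (3 * κ) * (F₀ + Real.exp (3 * μ) * (pB * Ccol)) * Real.exp (-(κ * d₀)) * ‖Y‖ with hA_def
    have hA : 0 ≤ A := by rw [hA_def]; positivity
    have hs' : s ≤ 2 * A :=
      calc s = A * lam⁻¹ := by rw [hs, hA_def, div_eq_mul_inv]
        _ ≤ A * 2 := mul_le_mul_of_nonneg_left hinv2 hA
        _ = 2 * A := by ring
    have hG0 : 0 ≤ 1 + lam⁻¹ + lam⁻¹ ^ 2 := by positivity
    calc s * (1 + lam⁻¹ + lam⁻¹ ^ 2) ≤ (2 * A) * (1 + lam⁻¹ + lam⁻¹ ^ 2) := mul_le_mul_of_nonneg_right hs' hG0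
      _ ≤ (2 * A) * 7 := mul_le_mul_of_nonneg_left hgeom (by positivity)
      _ = 14 * (8 * Real.exp (3 * κ) * (F₀ + Real.exp (3 * μ) * (pB * Ccol))) * Real.exp (-(κ * d₀)) * ‖Y‖ := by rw [hA_def]; ring
  have hterm2 : Real.sqrt (3 ^ 3 / (c₀ * ((F.L : ℝ) ^ (K - n)) ^ 3) * (lam ^ 3)⁻¹) * Real.sqrt EW2
      ≤ (Real.sqrt (3 ^ 3 / (c₀ * ((F.L : ℝ) ^ (K - n)) ^ 3) * 8) *
          Real.sqrt (8 * Real.exp (3 * κ) * Real.exp (6 * μ) * (2 * (1 + 1 / μ)) ^ 3) * Ccol) * Real.exp (-(κ / 2 * d₀)) * ‖Y‖ := by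
    have hL0 : (0 : ℝ) ≤ 3 ^ 3 / (c₀ * ((F.L : ℝ) ^ (K - n)) ^ 3) := by have := F.hL.2; positivity
    have h1 : Real.sqrt (3 ^ 3 / (c₀ * ((F.L : ℝ) ^ (K - n)) ^ 3) * (lam ^ 3)⁻¹) ≤ Real.sqrt (3 ^ 3 / (c₀ * ((F.L : ℝ) ^ (K - n)) ^ 3) * 8) :=
      Real.sqrt_le_sqrt (mul_le_mul_of_nonneg_left hlam3 hL0)
    have h2 : Real.sqrt EW2 = Real.sqrt (8 * Real.exp (3 * κ) * Real.exp (6 * μ) * (2 * (1 + 1 / μ)) ^ 3) * Ccol * ‖Y‖ * Real.exp (-(κ / 2 * d₀)) := by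
      rw [hEW2]
      have e1 : 8 * Real.exp (3 * κ) * Real.exp (6 * μ) * (2 * (1 + 1 / μ)) ^ 3 * Ccol ^ 2 * ‖Y‖ ^ 2 * Real.exp (-(κ * d₀))
          = (8 * Real.exp (3 * κ) * Real.exp (6 * μ) * (2 * (1 + 1 / μ)) ^ 3) * (Ccol * ‖Y‖ * Real.exp (-(κ / 2 * d₀))) ^ 2 := by
        rw [mul_pow, mul_pow, ← Real.exp_nat_mul]; push_cast; ring_nf
      rw [e1, Real.sqrt_mul (by positivity), Real.sqrt_sq (by positivity)]; ring
    rw [h2]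
    have hB : 0 ≤ Real.sqrt (8 * Real.exp (3 * κ) * Real.exp (6 * μ) * (2 * (1 + 1 / μ)) ^ 3) * Ccol * ‖Y‖ * Real.exp (-(κ / 2 * d₀)) := by positivity
    calc _ ≤ Real.sqrt (3 ^ 3 / (c₀ * ((F.L : ℝ) ^ (K - n)) ^ 3) * 8) * (Real.sqrt (8 * Real.exp (3 * κ) * Real.exp (6 * μ) * (2 * (1 + 1 / μ)) ^ 3) * Ccol * ‖Y‖ * Real.exp (-(κ / 2 * d₀))) :=
          mul_le_mul_of_nonneg_right h1 hB
      _ = _ := by ring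
  have hfinal := hmain.trans (add_le_add hterm1 hterm2)
  exact hfinal.trans (le_of_eq (by ring))

end Summit.QuantumFields.YangMills.Theorems.Prop7MassiveColumnPointwiseDecay

end
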